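import Literature.NumberTheory.EllipticCurves.EichlerShimuraCongruenceHondaProofs
import Literature.RingTheory.FormalGroups.HondaTypeFunctionalEquationII
import HarnessLib

/-!
# Honda's theorem at a good odd prime: the formal group of `E/ℤ_p` is strongly isomorphic over
# `ℤ_p` to the formal group of `L(E, s)` (Honda 1970, Thm. 9; proofs only)

Topic `NumberTheory/EllipticCurves` (theorems only; no definition, no named fact). For a globally
minimal elliptic curve `W/ℚ`, an odd prime `p` of good reduction, and the Dirichlet coefficients
`aₙ = aₙ(W)` of `L(W, s)` (Mathlib's `WeierstrassCurve.LFunction`), there is a power series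
`ψ ∈ Xℤ_p⟦X⟧` (`p`-integral coefficients, `ψ(0) = 0`, in fact `ψ = X + ⋯`) with

  `log_{W ⊗ ℚ_p}(ψ(X)) = Σₙ aₙ Xⁿ/n`       (`exists_padicInt_formalLog_subst_eq_lSeriesLog`),

i.e. `ψ = exp_W ∘ ℓ` is a STRICT ISOMORPHISM over `ℤ_p` from the formal group
`ℓ⁻¹(ℓ(X) + ℓ(Y))` of the `L`-series, `ℓ = Σ aₙXⁿ/n`, onto `Ŵ` — Honda, J. Math. Soc. Japan 22
(1970), Thm. 9 (p. 240: "Let `C` be a 1-dimensional abelian variety over `Q` and let `F` be a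
formal minimal model for `C` over `Z` … `F ≈ G` over `Z_S`"), here at one good odd prime. It is
the arithmetic input "Honda for `W'` alone" of the finite-height route to the integrality of the
Manin constant recorded in `NeronIsogenyScaling.lean`.

Proof (Honda 1970, §6.2; Hazewinkel 1978, I.2.2): both `log_W` (the tree's
`WeierstrassCurve.norm_coeff_hondaShift_subst_formalLog_le_one`, from `π² − a_pπ + p = 0` on `Ẽ`)
and `ℓ` (the Euler recursion `a_{pm} = a_p a_m − p a_{m/p}` of `L(W, s)` at a good prime,
`lFunction_prime_mul_of_hasGoodReduction`, from Mathlib's Euler product via the tree's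
`LFunction_apply_prime_pow_add_two` and `isMultiplicative_LFunction`; then
`norm_coeff_hondaShift_mk_div_le_one`) are of Honda type `p − a_pT + T²` with the SAME
`a_p = LFunction p = frobeniusTrace p` (`LFunction_apply_prime_eq_frobeniusTrace`), so the
functional equation lemma (ii) (`Literature.RingTheory.FormalGroups.norm_coeff_le_one_of_subst_eq`)
makes `ψ = log_W⁻¹ ∘ ℓ` integral.

## References

* T. Honda, *On the theory of commutative formal groups*, J. Math. Soc. Japan 22 (1970), 213–246:
  Thm. 2 (p. 223), §6.2 Thm. 9 (pp. 240–241) (held: `paper:doi-10-2969-jmsj-02220213`).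
  [Honda1970]
* T. Honda, *Formal groups and zeta-functions*, Osaka J. Math. 5 (1968), Thm. 5 (the original
  statement for elliptic curves over `ℚ`).
* M. Hazewinkel, *Formal Groups and Applications* (1978), Ch. I §2.2. [Hazewinkel1978]
* F. Diamond, J. Shurman, *A First Course in Modular Forms* (2005), §8.8 (8.44) (the recursion).
  [DiamondShurman2005]
-/

noncomputable section

open scoped Classical

namespace WeierstrassCurve

open PowerSeries Literature.RingTheory.FormalGroups Literature.NumberTheory.EllipticCurves
open ArithmeticFunction IsDedekindDomain NumberField Rat.HeightOneSpectrum

/-! ### The Euler recursion of `L(W, s)` at a good prime -/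

section Recursion

variable (W : WeierstrassCurve ℚ)

/-- **`a_{pm}(W) = a_p(W) a_m(W) − p · a_{m/p}(W)` at a prime `p` of good reduction** (with
`a_{m/p} = 0` when `p ∤ m`): the Euler factor `(1 − a_pT + pT²)⁻¹` of Mathlib's `L(W, s)` and
multiplicativity (Diamond–Shurman (8.44)). [cite: DiamondShurman2005, §8.8 (8.44)] -/
theorem lFunction_prime_mul_of_hasGoodReductionAt (v : HeightOneSpectrum (𝓞 ℚ))
    (hv : W.HasGoodReductionAt v) (m : ℕ) :
    W.LFunction ((primesEquiv v : ℕ) * m) =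
      W.LFunction (primesEquiv v : ℕ) * W.LFunction m -
        (primesEquiv v : ℕ) * (if (primesEquiv v : ℕ) ∣ m then W.LFunction (m / (primesEquiv v : ℕ)) else 0) := by
  set p : ℕ := (primesEquiv v : ℕ) with hpdef
  have hp : p.Prime := (primesEquiv v).2
  have hmult := W.isMultiplicative_LFunction
  rcases Nat.eq_zero_or_pos m with rfl | hm
  · simp [ArithmeticFunction.map_zero]
  obtain ⟨k, m', hm', rfl⟩ := Nat.exists_eq_pow_mul_and_not_dvd hm.ne' p hp.ne_one
  have hcop : ∀ j, Nat.Coprime (p ^ j) m' := fun j ↦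
    (Nat.Coprime.pow_left j ((Nat.Prime.coprime_iff_not_dvd hp).mpr hm'))
  have hrec := W.LFunction_apply_prime_pow_add_two v
  rw [if_pos hv, ← hpdef] at hrec
  rcases Nat.eq_zero_or_pos k with rfl | hk
  · rw [pow_zero, one_mul, if_neg hm', mul_zero, sub_zero,
      hmult.map_mul_of_coprime ((Nat.Prime.coprime_iff_not_dvd hp).mpr hm')]
  · obtain ⟨k, rfl⟩ := Nat.exists_eq_add_of_le' hk
    have hdvd : p ∣ p ^ (k + 1) * m' := Dvd.dvd.mul_right (dvd_pow_self p k.succ_ne_zero) _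
    rw [if_pos hdvd, show p * (p ^ (k + 1) * m') = p ^ (k + 2) * m' by ring,
      show p ^ (k + 1) * m' / p = p ^ k * m' by
        rw [pow_succ, mul_assoc, mul_comm p, ← mul_assoc, Nat.mul_div_cancel _ hp.pos],
      hmult.map_mul_of_coprime (hcop (k + 2)), hmult.map_mul_of_coprime (hcop (k + 1)),
      hmult.map_mul_of_coprime (hcop k), hrec k]
    ring

/-- The same at a rational prime `p ∤ Δ_min(W)` for a globally minimal `W`. [folklore] -/
theorem lFunction_prime_mul_of_not_dvd [W.IsGloballyMinimal] (p : ℕ) [hp : Fact p.Prime]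
    (hgood : ¬ (p : ℤ) ∣ minimalDiscriminantInt W) (m : ℕ) :
    W.LFunction (p * m) = W.LFunction p * W.LFunction m -
      p * (if p ∣ m then W.LFunction (m / p) else 0) := by
  obtain ⟨v, rfl⟩ : ∃ v : HeightOneSpectrum (𝓞 ℚ), (primesEquiv v : ℕ) = p :=
    ⟨primesEquiv.symm ⟨p, hp.out⟩, by rw [Equiv.apply_symm_apply]⟩
  exact W.lFunction_prime_mul_of_hasGoodReductionAt v
    ((hasGoodReductionAtPrime_iff_hasGoodReductionAt_ringOfIntegers v W).mp
      (hasGoodReductionAtPrime_of_not_dvd W _ hgood)) m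

/-- **`ℓ = Σ aₙ(W) Xⁿ/n` is of Honda type `p − a_pT + T²` over `ℚ_p`** at a good prime `p` of the
globally minimal `W` (Honda 1970, Thm. 8 with (6.2)). [cite: Honda1970, Thm. 8 with (6.2)] -/
theorem norm_coeff_hondaShift_lSeriesLog_le_one [W.IsGloballyMinimal] {p : ℕ} [hp : Fact p.Prime]
    (hgood : ¬ (p : ℤ) ∣ minimalDiscriminantInt W) (n : ℕ) :
    ‖PowerSeries.coeff n (hondaShift p ((W.LFunction p : ℤ) : ℚ_[p])
      (PowerSeries.mk fun k ↦ ((W.LFunction k : ℤ) : ℚ_[p]) / k))‖ ≤ 1 := by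
  refine norm_coeff_hondaShift_mk_div_le_one (fun k ↦ ((W.LFunction k : ℤ) : ℚ_[p])) ?_ ?_ ?_ n
  · rw [ArithmeticFunction.map_zero, Int.cast_zero]
  · intro m _
    rw [W.lFunction_prime_mul_of_not_dvd p hgood m]
    split_ifs <;> push_cast <;> ring
  · intro m
    exact Padic.norm_int_le_one _

end Recursion

/-! ### Honda's strong isomorphism -/

section Honda

variable {p : ℕ} [hp : Fact p.Prime]

/-- **Honda 1970, Thm. 9 at a good odd prime (strong isomorphism over `ℤ_p`).** For a globally
minimal elliptic `W/ℚ` and an odd prime `p ∤ Δ_min(W)` there is `ψ ∈ Xℚ_p⟦X⟧` with `p`-integral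
coefficients such that `log_{W ⊗ ℚ_p}(ψ) = Σₙ aₙ(W) Xⁿ/n`: the formal group of `W` over `ℤ_p` is
strongly isomorphic over `ℤ_p` to the formal group of its `L`-series.
[cite: Honda1970, Thm. 9 (pp. 240–241) and Thm. 2 (p. 223)] -/
theorem exists_padicInt_formalLog_subst_eq_lSeriesLog (hp2 : p ≠ 2) (W : WeierstrassCurve ℚ)
    [W.IsElliptic] [W.IsGloballyMinimal] (hgood : ¬ (p : ℤ) ∣ minimalDiscriminantInt W) :
    ∃ ψ : ℚ_[p]⟦X⟧, constantCoeff ψ = 0 ∧ (∀ n, ‖coeff n ψ‖ ≤ 1) ∧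
      (W.map (algebraMap ℚ ℚ_[p])).formalLog.subst ψ =
        PowerSeries.mk fun k ↦ ((W.LFunction k : ℤ) : ℚ_[p]) / k := by
  set log := (W.map (algebraMap ℚ ℚ_[p])).formalLog with hlog
  set ℓ : ℚ_[p]⟦X⟧ := PowerSeries.mk fun k ↦ ((W.LFunction k : ℤ) : ℚ_[p]) / k with hℓ
  have hlog0 : constantCoeff log = 0 := constantCoeff_formalLog _
  have hlog1 : coeff 1 log = 1 := coeff_one_formalLog _
  have hunit : IsUnit (coeff 1 log) := by rw [hlog1]; exact isUnit_one
  have hℓ0 : constantCoeff ℓ = 0 := by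
    rw [hℓ, ← coeff_zero_eq_constantCoeff_apply, coeff_mk, Nat.cast_zero, div_zero]
  have hsℓ : HasSubst ℓ := HasSubst.of_constantCoeff_zero' hℓ0
  set inv := log.substInvOfIsUnit hunit with hinv
  have hsinv : HasSubst inv := HasSubst.substInvOfIsUnit log hunit
  set ψ := inv.subst ℓ with hψ
  have hψ0 : constantCoeff ψ = 0 :=
    constantCoeff_subst_eq_zero hℓ0 inv (constantCoeff_substInvOfIsUnit log hunit)
  have hlogψ : log.subst ψ = ℓ := by
    rw [hψ, ← subst_comp_subst_apply hsinv hsℓ, hinv, subst_substInvOfIsUnit_right log hlog0 hunit,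
      subst_X hsℓ]
  refine ⟨ψ, hψ0, fun n ↦ ?_, hlogψ⟩
  -- both `log` and `ℓ` are of Honda type `p − a_pT + T²`, `a_p = LFunction p = frobeniusTrace p`
  have hap : W.LFunction p = W.frobeniusTrace p :=
    LFunction_apply_prime_eq_frobeniusTrace W p (hasGoodReductionAtPrime_of_not_dvd W p hgood)
  have ha : ‖((W.LFunction p : ℤ) : ℚ_[p])‖ ≤ 1 := Padic.norm_int_le_one _
  have hT₁ : ∀ m, ‖coeff m (hondaShift p ((W.LFunction p : ℤ) : ℚ_[p]) log)‖ ≤ 1 := fun m ↦ by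
    have h := norm_coeff_hondaShift_subst_formalLog_le_one hp2 W hgood (θ := PowerSeries.X)
      constantCoeff_X (fun k ↦ by rw [coeff_X]; split_ifs <;> simp) m
    rwa [powerSeries_subst_X_self, ← hap] at h
  have hT₂ := W.norm_coeff_hondaShift_lSeriesLog_le_one hgood
  have h1 : ‖coeff 1 log‖ = 1 := by rw [hlog1, norm_one]
  exact norm_coeff_le_one_of_subst_eq ha hT₁ hT₂ h1 hψ0 hlogψ n

end Honda

end WeierstrassCurve
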